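import Literature.NumberTheory.Automorphic.UnitaryGroupUnipotentBracketIntegrable
import Literature.NumberTheory.Automorphic.UnitaryGroupTruncatedTraceClassPolynomialGlue
import Literature.NumberTheory.Automorphic.UnitaryGroupTruncatedKernelClassIntegrableHolds
import Literature.NumberTheory.Automorphic.UnitaryGroupTruncatedKernelIntegrableCM
import Literature.NumberTheory.Automorphic.UnitaryGroupBorelRefinedClassMap
import Literature.NumberTheory.Automorphic.GLnIwasawaIntegration
import HarnessLib

/-!
# Assembly of the unipotent term: `J^T_𝔬(f) = A·log T + B` for `T ≫ 0` at the central class `𝔬 = z·𝒰(F)` of `U(J₃)`,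
# from the unfolded form and the centre-lattice ∕ Heisenberg evaluations; the class polynomial `p_𝔬 = A·X + B`
(Rogawski, *Automorphic Representations of Unitary Groups in Three Variables* (1990), Prop. 7.3.2 (pp. 96–97):
`J^T_G(𝔬, f)` for `𝔬 = z·𝒰` is the sum of the five terms (a)–(e), linear in `log T`; Arthur, *The trace formula in
invariant form*, Ann. of Math. 114 (1981), Prop. 2.3: `J^T_𝔬(f)` is a polynomial in `log T` and `J_𝔬(f)` is its constant
term.)

Topic `NumberTheory/Automorphic`; namespace `Literature.NumberTheory.Automorphic.UnitaryGroup`. THEOREMS ONLY over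
accepted tree modules (no definition, no named fact, no instance, no notation, no `sorry`). Row (F) «ASSEMBLY» of item
(L5-i) «the unipotent term `P_{z·𝒰}`» of the T1-qs LAW 5 road of `Cruxes/H413/Lines/F0_T1InnerFormTraceIdentity.lean`
(cell `pub/hodgecm-mathlib`, crux H413). HYPOTHESES-FIRST in the three analytic evaluations of the print, which enter
in FUNCTION-GENERIC letters so that their holders dock by `exact`:

* the SPLIT of the unfolded bracket of ★ B1 `truncatedTraceClass_central_eq_add_mul_integral`
  (`UnitaryGroupTruncatedTraceClassUnipotentUnfold`), `ψ_T(g) = Σ'_{u ∈ N(F), u ≠ 1} f(g⁻¹ z₁ u g) − 1_{T < H(g)} K_{B,𝔬}(g,g)`,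
  as `ψ_T(g) = ψᶜ(g) + ψʳ_T(g)` — the centre-lattice part `ψᶜ` (`u = n(w)`, `w ∈ E⁰ ∖ 0`) and the Heisenberg part with the
  tail `ψʳ_T` [Rogawski1990, p. 96, the decomposition of `Σ_{u ∈ N − {1}}` by the coordinate `x` of `u = u(x, w)`];
* (C) the centre-lattice evaluation `∫_G β ψᶜ dν_G = Cc` (terms (c)+(d) of Prop. 7.3.2, via (7.3.2));
* (E) the Heisenberg evaluation `∫_G β ψʳ_T dν_G = A·log T + B` for `T ≫ 0` (terms (b)+(e), via (7.3.3) and Lemma 7.1.1);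

and in the integrability `hkint` of `k^T_𝔬` on `X` (★ LAW 3, discharged at the CM pin in §3). OUTPUT (§1):
`J^T_𝔬(f) = (c_μ A)·log T + (μ(X)·f(z₁) + c_μ (Cc + B))` for `T ≫ 0` — ★ B1 with its two binders discharged (`hsum` by ★
`summable_kernel_of_hasCompactSupport`, `hint` by ★ (HINT) `exists_forall_lintegral_weight_mul_enorm_bracket_lt_top`) and
Bochner additivity; (§2) hence, by ★ GLUE `classPolynomial_eq_C_mul_X_add_C`, every polynomial computing `J^T_𝔬(f)` at
`log T` for `T ≫ 0` — the class polynomial `p_𝔬` of ★ `truncatedTraceClassPolynomial_cm` ∕ of the socket ★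
`arthurTrace_eq_sum_orbital_add_sum_central_add_sum_singular_add_sum_hyperbolic_cm` — is `C (c_μ A)·X + C (μ(X)·f(z₁) +
c_μ (Cc + B))`, with constant term THE UNIPOTENT TERM `p_𝔬(0) = μ(X)·f(z₁) + c_μ (Cc + B)`; (§3) the same at the CM pair
`(L⁺, L, complexConj)` with `hkint` discharged (★ `truncatedKernelClassIntegrable_cm`) for a TEST function `f`, and the
fibre letter `hcl` of the socket's Borel-refined class map `cl♭` at the central class `(((X − z)³).map, true)` (★
`forall_exists_conj_mem_arithmeticBorel_of_charpoly_eq_pow_three`: the flag is automatic).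

Letters as in ★ B1: `ζ : ratOne F E c` (`z ∈ E¹`), `z₁ ∈ G(F)` with `↑z₁ = ι(ratCenter ζ)`, the class `cl⁻¹{i}` of
characteristic polynomial `(X − z)³`, `ν` a Haar measure of `N(𝔸_F)`, `𝓕` a fundamental domain of `N(F)`, `μ` an
automorphic measure, `ν_G` an inversion-invariant Haar measure of `G(𝔸_F)`, `β` a covering weight of `B(F)♯`,
`c_μ = unfoldingConstant G(F) count μ ν_G`.

## References

* J. D. Rogawski, *Automorphic Representations of Unitary Groups in Three Variables*, Annals of Mathematics Studies
  123 (1990), Prop. 7.3.2 (pp. 96–97), §7.3 (p. 95), §2.2–2.3 (pp. 13–14) [Rogawski1990].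
* J. Arthur, *The trace formula in invariant form*, Ann. of Math. 114 (1981), Prop. 2.3
  [Arthur1981TraceFormulaInvariantForm].
* J. Arthur, *A trace formula for reductive groups I*, Duke Math. J. 45 (1978), Thm. 7.1, §8 [Arthur1978TraceFormulaI].
-/

set_option autoImplicit false

noncomputable section

open MeasureTheory Measure NumberField IsDedekindDomain Set Polynomial Literature.MeasureTheory.Group
open scoped MatrixGroups NNReal ENNReal

namespace Literature.NumberTheory.Automorphic

namespace UnitaryGroup

variable {F E : Type} [Field F] [NumberField F] [Field E] [NumberField E] [Algebra F E]
  {c : E ≃ₐ[F] E} {ι : Type*}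

/-! ## §1 `J^T_𝔬(f) = (c_μ A)·log T + (μ(X)·f(z₁) + c_μ (Cc + B))` for `T ≫ 0`, from the parts -/

section Generic

variable (ζ : ratOne F E c) {z₁ : (quasiSplit F E c 3).arithmeticSubgroup}
  [MeasurableSpace (adelicUnipotent F E c 3)] [BorelSpace (adelicUnipotent F E c 3)]
  [MeasurableSpace (quasiSplit F E c 3).Adelic] [BorelSpace (quasiSplit F E c 3).Adelic]

/-- **ASSEMBLY OF THE UNIPOTENT TERM (hypotheses-first).** For `f ∈ C_c(G(𝔸_F))`, an automorphic measure `μ`, an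
inversion-invariant Haar measure `ν_G`, a covering weight `β` of `B(F)♯`, GIVEN (i) the integrability of `k^T_𝔬` on `X`
for `T ≫ 0`, (ii) a pointwise split `ψ_T = ψᶜ + ψʳ_T` of the unfolded bracket, (iii) `β·ψᶜ` integrable with
`∫_G β ψᶜ dν_G = Cc`, and (iv) for `T ≫ 0`, `β·ψʳ_T` integrable with `∫_G β ψʳ_T dν_G = A·log T + B`: there is `T₂` with
`J^T_𝔬(f) = (c_μ A)·log T + (μ(X)·f(z₁) + c_μ (Cc + B))` for all `T > T₂` — [Rogawski1990, Prop. 7.3.2]: «`J^T_G(𝔬, f)`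
is equal to the sum of the following five terms», (a) `= μ(X) f(z₁)`, (c)+(d) `= c_μ Cc`, (b)+(e) `= c_μ (A log T + B)`.
★ B1 `truncatedTraceClass_central_eq_add_mul_integral` with `hsum` (★ `summable_kernel_of_hasCompactSupport`) and
`hint` (★ `exists_forall_lintegral_weight_mul_enorm_bracket_lt_top`) discharged, then `∫ β(ψᶜ + ψʳ_T) = ∫ βψᶜ + ∫ βψʳ_T`.
[cite: Rogawski1990, Prop. 7.3.2 (pp. 96–97)] [cite: Arthur1978TraceFormulaI, §8] -/
theorem truncatedTraceClass_central_eq_linear_of_parts {cl : (quasiSplit F E c 3).arithmeticSubgroup → ι}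
    (hc : c * c = 1) (hc1 : c ≠ 1)
    (hz₁ : (z₁ : (quasiSplit F E c 3).Adelic) =
      (quasiSplit F E c 3).toAdelic (ratCenter F E c 3 ((StdForm.antidiagonal 3).over E) ζ))
    {i : ι} (hcl : ∀ γ : (quasiSplit F E c 3).arithmeticSubgroup, cl γ = i ↔
      ((adelicVal F E c 3 _ (γ : (quasiSplit F E c 3).Adelic) : GL (Fin 3) (AdeleRing (𝓞 E) E)) :
          Matrix (Fin 3) (Fin 3) (AdeleRing (𝓞 E) E)).charpoly =
        ((X - C ((ζ : Eˣ) : E)) ^ 3).map (algebraMap E (AdeleRing (𝓞 E) E)))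
    (hclN : IsUnipotentInvariantOnBorel F E c 3 cl)
    (ν : Measure (adelicUnipotent F E c 3)) [ν.IsHaarMeasure]
    {𝓕 : Set (adelicUnipotent F E c 3)} (h𝓕 : IsFundamentalDomain (rationalUnipotent F E c 3) 𝓕 ν)
    {f : (quasiSplit F E c 3).Adelic → ℂ} (hfc : Continuous f) (hf : HasCompactSupport f)
    (μ : Measure (quasiSplit F E c 3).automorphicQuotient) [(quasiSplit F E c 3).IsAutomorphicMeasure μ]
    (νG : Measure (quasiSplit F E c 3).Adelic) [νG.IsHaarMeasure] [νG.IsInvInvariant]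
    {β : (quasiSplit F E c 3).Adelic → ℝ≥0∞}
    (hβ : IsCoveringWeight ((arithmeticBorel F E c 3).map (quasiSplit F E c 3).arithmeticSubgroup.subtype) β)
    (hkint : ∃ T₀ : ℝ≥0, ∀ T : ℝ≥0, T₀ < T →
      Integrable ((quasiSplit F E c 3).quotFun (truncatedKernelClass ν 𝓕 T cl i f)) μ)
    {ψc : (quasiSplit F E c 3).Adelic → ℂ} {ψr : ℝ≥0 → (quasiSplit F E c 3).Adelic → ℂ}
    (hsplit : ∀ (T : ℝ≥0) (g : (quasiSplit F E c 3).Adelic),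
      (∑' u : {u : rationalUnipotent F E c 3 // u ≠ 1},
        f (g⁻¹ * ((z₁ * ⟨(((u.1 : rationalUnipotent F E c 3) : adelicUnipotent F E c 3) :
          (quasiSplit F E c 3).Adelic), (u.1 : rationalUnipotent F E c 3).2⟩ :
            (quasiSplit F E c 3).arithmeticSubgroup) : (quasiSplit F E c 3).Adelic) * g)) -
        kernelBorelTailClass ν 𝓕 T cl i f g = ψc g + ψr T g)
    {Cc A B : ℂ}
    (hCi : Integrable (fun g => (β g).toReal • ψc g) νG)
    (hCv : ∫ g, (β g).toReal • ψc g ∂νG = Cc)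
    (hE : ∃ T₁ : ℝ≥0, ∀ T : ℝ≥0, T₁ < T →
      Integrable (fun g => (β g).toReal • ψr T g) νG ∧
        ∫ g, (β g).toReal • ψr T g ∂νG = A * ((Real.log (T : ℝ) : ℝ) : ℂ) + B) :
    haveI := t2Space_adeleRing_of_numberField E
    haveI := locallyCompactSpace_adeleRing' E
    haveI := secondCountableTopology_adeleRing E
    haveI : T2Space (quasiSplit F E c 3).Adelic :=
      inferInstanceAs (T2Space (adelic F E c 3 ((StdForm.antidiagonal 3).over E)))
    haveI : LocallyCompactSpace (quasiSplit F E c 3).Adelic :=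
      inferInstanceAs (LocallyCompactSpace (adelic F E c 3 ((StdForm.antidiagonal 3).over E)))
    haveI : SecondCountableTopology (quasiSplit F E c 3).Adelic :=
      inferInstanceAs (SecondCountableTopology (adelic F E c 3 ((StdForm.antidiagonal 3).over E)))
    haveI : DiscreteTopology (quasiSplit F E c 3).quotientSubgroup := by
      rw [quotientSubgroup_quasiSplit]; exact isDiscreteRational_quasiSplit
    letI := AdelicGroupData.measurableSpaceQuotientForm (quasiSplit F E c 3)
    haveI := AdelicGroupData.borelSpaceQuotientForm (quasiSplit F E c 3)
    haveI := AdelicGroupData.smulInvariantMeasureQuotientForm (quasiSplit F E c 3) μ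
    haveI := AdelicGroupData.isFiniteMeasureOnCompactsQuotientForm (quasiSplit F E c 3) μ
    ∃ T₂ : ℝ≥0, ∀ T : ℝ≥0, T₂ < T →
      truncatedTraceClass μ ν 𝓕 T cl i f =
        ((unfoldingConstant (quasiSplit F E c 3).quotientSubgroup
            (count : Measure (quasiSplit F E c 3).quotientSubgroup) μ νG : ℝ) : ℂ) * A *
            ((Real.log (T : ℝ) : ℝ) : ℂ) +
          ((μ.real Set.univ : ℝ) • f (z₁ : (quasiSplit F E c 3).Adelic) +
            ((unfoldingConstant (quasiSplit F E c 3).quotientSubgroup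
              (count : Measure (quasiSplit F E c 3).quotientSubgroup) μ νG : ℝ) : ℂ) * (Cc + B)) := by
  haveI := t2Space_adeleRing_of_numberField E
  haveI := locallyCompactSpace_adeleRing' E
  haveI := secondCountableTopology_adeleRing E
  haveI : T2Space (quasiSplit F E c 3).Adelic :=
    inferInstanceAs (T2Space (adelic F E c 3 ((StdForm.antidiagonal 3).over E)))
  haveI : LocallyCompactSpace (quasiSplit F E c 3).Adelic :=
    inferInstanceAs (LocallyCompactSpace (adelic F E c 3 ((StdForm.antidiagonal 3).over E)))
  haveI : SecondCountableTopology (quasiSplit F E c 3).Adelic :=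
    inferInstanceAs (SecondCountableTopology (adelic F E c 3 ((StdForm.antidiagonal 3).over E)))
  haveI : DiscreteTopology (quasiSplit F E c 3).quotientSubgroup := by
    rw [quotientSubgroup_quasiSplit]; exact isDiscreteRational_quasiSplit
  letI := AdelicGroupData.measurableSpaceQuotientForm (quasiSplit F E c 3)
  haveI := AdelicGroupData.borelSpaceQuotientForm (quasiSplit F E c 3)
  haveI := AdelicGroupData.smulInvariantMeasureQuotientForm (quasiSplit F E c 3) μ
  haveI := AdelicGroupData.isFiniteMeasureOnCompactsQuotientForm (quasiSplit F E c 3) μ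
  obtain ⟨T₀, hT₀⟩ := hkint
  obtain ⟨Th, hTh⟩ := exists_forall_lintegral_weight_mul_enorm_bracket_lt_top ζ hc hc1 hz₁ hcl hclN ν h𝓕 hfc hf μ νG hβ
  obtain ⟨T₁, hT₁⟩ := hE
  refine ⟨max (max T₀ Th) T₁, fun T hT => ?_⟩
  have hT0 : T₀ < T := lt_of_le_of_lt ((le_max_left _ _).trans (le_max_left _ _)) hT
  have hTh' : Th < T := lt_of_le_of_lt ((le_max_right _ _).trans (le_max_left _ _)) hT
  have hT1 : T₁ < T := lt_of_le_of_lt (le_max_right _ _) hT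
  have hTpos : 0 < T := pos_of_gt hT
  -- B1's two binders: the class sum is a finite sum, the bracket is absolutely integrable above the (HINT) threshold
  have hsum : ∀ x : (quasiSplit F E c 3).Adelic, Summable fun γ : cl ⁻¹' {i} =>
      f (x⁻¹ * (((γ : cl ⁻¹' {i}) : (quasiSplit F E c 3).arithmeticSubgroup) : (quasiSplit F E c 3).Adelic) * x) :=
    fun x => (summable_kernel_of_hasCompactSupport hf x x).subtype _
  have hint := hTh T hTh' (hT₀ T hT0)
  obtain ⟨hEi, hEv⟩ := hT₁ T hT1
  rw [truncatedTraceClass_central_eq_add_mul_integral ζ hc hc1 hz₁ hcl hclN ν h𝓕 hTpos hfc hf μ νG hβ hsum hint]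
  simp_rw [hsplit T, smul_add]
  rw [integral_add hCi hEi, hCv, hEv]
  ring

end Generic

/-! ## §2 The class polynomial: `p_𝔬 = C A'·X + C B'`, `p_𝔬(0) = B'`, `p_𝔬.coeff 1 = A'` -/

section ClassPolynomial

variable {N : ℕ} [NeZero N] [MeasurableSpace (adelicUnipotent F E c N)]
  {cl : (quasiSplit F E c N).arithmeticSubgroup → ι}
  {μ : Measure (quasiSplit F E c N).automorphicQuotient}
  {ν : Measure (adelicUnipotent F E c N)} {𝓕 : Set (adelicUnipotent F E c N)}
  {f : (quasiSplit F E c N).Adelic → ℂ}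

/-- **ROW CLOSER IN THRESHOLD FORM ⇒ CLASS POLYNOMIAL** (★ GLUE, the `∃ T₂`-packaged reading used by §1 and §3): if a
polynomial `p` computes `J^T_𝔬(f)` at `log T` for `T > T₀` (the LAW-3 closer ★ `truncatedTraceClassPolynomial_cm` ∕ the
socket's `P i`) and `J^T_𝔬(f) = A'·log T + B'` for `T ≫ 0`, then `p = C A'·X + C B'`, `p(0) = B'` — the class's
contribution `J_𝔬(f)` to `J(f)` — and `p.coeff 1 = A'`. [cite: Arthur1981TraceFormulaInvariantForm, Prop. 2.3]
[cite: Rogawski1990, §2.2–2.3 (pp. 13–14)] -/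
theorem classPolynomial_eq_and_eval_zero_eq_of_exists_linear {i : ι} {p : ℂ[X]} {T₀ : ℝ≥0} {A' B' : ℂ}
    (hP : ∀ T : ℝ≥0, T₀ < T → truncatedTraceClass μ ν 𝓕 T cl i f = p.eval ((Real.log (T : ℝ) : ℝ) : ℂ))
    (hrow : ∃ T₂ : ℝ≥0, ∀ T : ℝ≥0, T₂ < T →
      truncatedTraceClass μ ν 𝓕 T cl i f = A' * ((Real.log (T : ℝ) : ℝ) : ℂ) + B') :
    p = C A' * X + C B' ∧ p.eval 0 = B' ∧ p.coeff 1 = A' := by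
  obtain ⟨T₂, hT₂⟩ := hrow
  exact ⟨classPolynomial_eq_C_mul_X_add_C hP hT₂, classPolynomial_eval_zero_eq hP hT₂,
    polynomial_coeff_one_eq_of_forall_eval_log_eq (J := fun T => truncatedTraceClass μ ν 𝓕 T cl i f) hP hT₂⟩

end ClassPolynomial

/-! ## §3 At the CM pin `(L⁺, L, complexConj)`: `hkint` discharged; the socket's fibre letter at the central class -/

section CM

open scoped Classical in
/-- **THE FIBRE LETTER `hcl` OF THE SOCKET'S CLASS MAP AT THE CENTRAL CLASS**: for the Borel-refined
characteristic-polynomial class map `cl♭ γ = (charpoly γ, [∃ δ ∈ G(F), δ γ δ⁻¹ ∈ B(F)])` and `z ∈ E¹`,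
`cl♭ γ = (((X − z)³).map, true) ↔ charpoly γ = ((X − z)³).map` — the flag is automatic because EVERY rational element
of characteristic polynomial `(X − z)³` is `G(F)`-conjugate into `B(F)` (★
`forall_exists_conj_mem_arithmeticBorel_of_charpoly_eq_pow_three`, Rogawski's Prop. 3.9.1). This is B1's `hcl` for
`cl := cl♭`, `i := (((X − z)³).map, true)` (with `hclN :=` ★ `isUnipotentInvariantOnBorel_borelRefine
isUnipotentInvariantOnBorel_charpoly_adelicVal`). [cite: Rogawski1990, Prop. 3.9.1 (p. 32)] [cite: Rogawski1990, §2.2 (p. 13)] -/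
theorem borelRefine_charpoly_eq_central_iff (hc : c * c = 1) (ζ : ratOne F E c)
    (γ : (quasiSplit F E c 3).arithmeticSubgroup) :
    (fun γ : (quasiSplit F E c 3).arithmeticSubgroup =>
        (((adelicVal F E c 3 _ (γ : (quasiSplit F E c 3).Adelic) : GL (Fin 3) (AdeleRing (𝓞 E) E)) :
            Matrix (Fin 3) (Fin 3) (AdeleRing (𝓞 E) E)).charpoly,
          decide (∃ δ : (quasiSplit F E c 3).arithmeticSubgroup, δ * γ * δ⁻¹ ∈ arithmeticBorel F E c 3))) γ =
        (((X - C ((ζ : Eˣ) : E)) ^ 3).map (algebraMap E (AdeleRing (𝓞 E) E)), true) ↔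
      ((adelicVal F E c 3 _ (γ : (quasiSplit F E c 3).Adelic) : GL (Fin 3) (AdeleRing (𝓞 E) E)) :
          Matrix (Fin 3) (Fin 3) (AdeleRing (𝓞 E) E)).charpoly =
        ((X - C ((ζ : Eˣ) : E)) ^ 3).map (algebraMap E (AdeleRing (𝓞 E) E)) := by
  simp only [Prod.mk.injEq, decide_eq_true_eq]
  exact ⟨fun h => h.1, fun h => ⟨h,
    forall_exists_conj_mem_arithmeticBorel_of_charpoly_eq_pow_three hc (conj_mul_self_of_ratOne ζ) γ h⟩⟩

/-- **ASSEMBLY OF THE UNIPOTENT TERM FOR THE QUASI-SPLIT `U(J₃)` OF A CM FIELD** — §1 at the CM pair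
`(L⁺, L, complexConj)` for a TEST function `f` (★ `IsQuasiSplitTest`), a conjugation-invariant `N(F)`-saturated class
map `cl` with central fibre `cl⁻¹{i} = {charpoly = (X − z)³}`, and any Haar measure `ν_G` of `G(𝔸)` (unimodular, ★
`isMulRightInvariant_quasiSplit_cm_three`): the LAW-3 integrability `hkint` of §1 is DISCHARGED by ★
`truncatedKernelClassIntegrable_cm`; what remains are the three evaluations (split, (C), (E)) of [Rogawski1990,
Prop. 7.3.2]. Conclusion: `J^T_𝔬(f) = (c_μ A)·log T + (μ(X)·f(z₁) + c_μ (Cc + B))` for `T ≫ 0`.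
[cite: Rogawski1990, Prop. 7.3.2 (pp. 96–97)] [cite: Arthur1978TraceFormulaI, Thm. 7.1, §8] -/
theorem truncatedTraceClass_central_eq_linear_cm_of_parts (L : Type) [Field L] [NumberField L] [IsCMField L]
    [MeasurableSpace (adelicUnipotent (↥(maximalRealSubfield L)) L (IsCMField.complexConj L) 3)]
    [BorelSpace (adelicUnipotent (↥(maximalRealSubfield L)) L (IsCMField.complexConj L) 3)]
    [MeasurableSpace (quasiSplit (↥(maximalRealSubfield L)) L (IsCMField.complexConj L) 3).Adelic]
    [BorelSpace (quasiSplit (↥(maximalRealSubfield L)) L (IsCMField.complexConj L) 3).Adelic]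
    (ζ : ratOne (↥(maximalRealSubfield L)) L (IsCMField.complexConj L))
    {z₁ : (quasiSplit (↥(maximalRealSubfield L)) L (IsCMField.complexConj L) 3).arithmeticSubgroup}
    (hz₁ : (z₁ : (quasiSplit (↥(maximalRealSubfield L)) L (IsCMField.complexConj L) 3).Adelic) =
      (quasiSplit (↥(maximalRealSubfield L)) L (IsCMField.complexConj L) 3).toAdelic
        (ratCenter (↥(maximalRealSubfield L)) L (IsCMField.complexConj L) 3 ((StdForm.antidiagonal 3).over L) ζ))
    {cl : (quasiSplit (↥(maximalRealSubfield L)) L (IsCMField.complexConj L) 3).arithmeticSubgroup → ι}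
    (hcl' : IsConjInvariant cl)
    {i : ι} (hcl : ∀ γ : (quasiSplit (↥(maximalRealSubfield L)) L (IsCMField.complexConj L) 3).arithmeticSubgroup,
      cl γ = i ↔
      ((adelicVal (↥(maximalRealSubfield L)) L (IsCMField.complexConj L) 3 _
            (γ : (quasiSplit (↥(maximalRealSubfield L)) L (IsCMField.complexConj L) 3).Adelic) :
            GL (Fin 3) (AdeleRing (𝓞 L) L)) : Matrix (Fin 3) (Fin 3) (AdeleRing (𝓞 L) L)).charpoly =
        ((X - C ((ζ : Lˣ) : L)) ^ 3).map (algebraMap L (AdeleRing (𝓞 L) L)))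
    (hclN : IsUnipotentInvariantOnBorel (↥(maximalRealSubfield L)) L (IsCMField.complexConj L) 3 cl)
    (ν : Measure (adelicUnipotent (↥(maximalRealSubfield L)) L (IsCMField.complexConj L) 3)) [ν.IsHaarMeasure]
    {𝓕 : Set (adelicUnipotent (↥(maximalRealSubfield L)) L (IsCMField.complexConj L) 3)}
    (h𝓕 : IsFundamentalDomain (rationalUnipotent (↥(maximalRealSubfield L)) L (IsCMField.complexConj L) 3) 𝓕 ν)
    {f : (quasiSplit (↥(maximalRealSubfield L)) L (IsCMField.complexConj L) 3).Adelic → ℂ}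
    (hf : IsQuasiSplitTest (↥(maximalRealSubfield L)) L (IsCMField.complexConj L) 3 f)
    (μ : Measure (quasiSplit (↥(maximalRealSubfield L)) L (IsCMField.complexConj L) 3).automorphicQuotient)
    [(quasiSplit (↥(maximalRealSubfield L)) L (IsCMField.complexConj L) 3).IsAutomorphicMeasure μ]
    (νG : Measure (quasiSplit (↥(maximalRealSubfield L)) L (IsCMField.complexConj L) 3).Adelic) [νG.IsHaarMeasure]
    {β : (quasiSplit (↥(maximalRealSubfield L)) L (IsCMField.complexConj L) 3).Adelic → ℝ≥0∞}
    (hβ : IsCoveringWeight ((arithmeticBorel (↥(maximalRealSubfield L)) L (IsCMField.complexConj L) 3).map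
      (quasiSplit (↥(maximalRealSubfield L)) L (IsCMField.complexConj L) 3).arithmeticSubgroup.subtype) β)
    {ψc : (quasiSplit (↥(maximalRealSubfield L)) L (IsCMField.complexConj L) 3).Adelic → ℂ}
    {ψr : ℝ≥0 → (quasiSplit (↥(maximalRealSubfield L)) L (IsCMField.complexConj L) 3).Adelic → ℂ}
    (hsplit : ∀ (T : ℝ≥0) (g : (quasiSplit (↥(maximalRealSubfield L)) L (IsCMField.complexConj L) 3).Adelic),
      (∑' u : {u : rationalUnipotent (↥(maximalRealSubfield L)) L (IsCMField.complexConj L) 3 // u ≠ 1},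
        f (g⁻¹ * ((z₁ * ⟨(((u.1 : rationalUnipotent (↥(maximalRealSubfield L)) L (IsCMField.complexConj L) 3) :
          adelicUnipotent (↥(maximalRealSubfield L)) L (IsCMField.complexConj L) 3) :
          (quasiSplit (↥(maximalRealSubfield L)) L (IsCMField.complexConj L) 3).Adelic),
            (u.1 : rationalUnipotent (↥(maximalRealSubfield L)) L (IsCMField.complexConj L) 3).2⟩ :
            (quasiSplit (↥(maximalRealSubfield L)) L (IsCMField.complexConj L) 3).arithmeticSubgroup) :
            (quasiSplit (↥(maximalRealSubfield L)) L (IsCMField.complexConj L) 3).Adelic) * g)) -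
        kernelBorelTailClass ν 𝓕 T cl i f g = ψc g + ψr T g)
    {Cc A B : ℂ}
    (hCi : Integrable (fun g => (β g).toReal • ψc g) νG)
    (hCv : ∫ g, (β g).toReal • ψc g ∂νG = Cc)
    (hE : ∃ T₁ : ℝ≥0, ∀ T : ℝ≥0, T₁ < T →
      Integrable (fun g => (β g).toReal • ψr T g) νG ∧
        ∫ g, (β g).toReal • ψr T g ∂νG = A * ((Real.log (T : ℝ) : ℝ) : ℂ) + B) :
    haveI := t2Space_adeleRing_of_numberField L
    haveI := locallyCompactSpace_adeleRing' L
    haveI := secondCountableTopology_adeleRing L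
    haveI : T2Space (quasiSplit (↥(maximalRealSubfield L)) L (IsCMField.complexConj L) 3).Adelic :=
      inferInstanceAs (T2Space (adelic (↥(maximalRealSubfield L)) L (IsCMField.complexConj L) 3
        ((StdForm.antidiagonal 3).over L)))
    haveI : LocallyCompactSpace (quasiSplit (↥(maximalRealSubfield L)) L (IsCMField.complexConj L) 3).Adelic :=
      inferInstanceAs (LocallyCompactSpace (adelic (↥(maximalRealSubfield L)) L (IsCMField.complexConj L) 3
        ((StdForm.antidiagonal 3).over L)))
    haveI : SecondCountableTopology (quasiSplit (↥(maximalRealSubfield L)) L (IsCMField.complexConj L) 3).Adelic :=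
      inferInstanceAs (SecondCountableTopology (adelic (↥(maximalRealSubfield L)) L (IsCMField.complexConj L) 3
        ((StdForm.antidiagonal 3).over L)))
    haveI : DiscreteTopology (quasiSplit (↥(maximalRealSubfield L)) L (IsCMField.complexConj L) 3).quotientSubgroup := by
      rw [quotientSubgroup_quasiSplit]; exact isDiscreteRational_quasiSplit
    letI := AdelicGroupData.measurableSpaceQuotientForm (quasiSplit (↥(maximalRealSubfield L)) L (IsCMField.complexConj L) 3)
    haveI := AdelicGroupData.borelSpaceQuotientForm (quasiSplit (↥(maximalRealSubfield L)) L (IsCMField.complexConj L) 3)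
    haveI := AdelicGroupData.smulInvariantMeasureQuotientForm
      (quasiSplit (↥(maximalRealSubfield L)) L (IsCMField.complexConj L) 3) μ
    haveI := AdelicGroupData.isFiniteMeasureOnCompactsQuotientForm
      (quasiSplit (↥(maximalRealSubfield L)) L (IsCMField.complexConj L) 3) μ
    ∃ T₂ : ℝ≥0, ∀ T : ℝ≥0, T₂ < T →
      truncatedTraceClass μ ν 𝓕 T cl i f =
        ((unfoldingConstant (quasiSplit (↥(maximalRealSubfield L)) L (IsCMField.complexConj L) 3).quotientSubgroup
            (count : Measure (quasiSplit (↥(maximalRealSubfield L)) L (IsCMField.complexConj L) 3).quotientSubgroup)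
            μ νG : ℝ) : ℂ) * A * ((Real.log (T : ℝ) : ℝ) : ℂ) +
          ((μ.real Set.univ : ℝ) • f (z₁ : (quasiSplit (↥(maximalRealSubfield L)) L (IsCMField.complexConj L) 3).Adelic) +
            ((unfoldingConstant (quasiSplit (↥(maximalRealSubfield L)) L (IsCMField.complexConj L) 3).quotientSubgroup
              (count : Measure (quasiSplit (↥(maximalRealSubfield L)) L (IsCMField.complexConj L) 3).quotientSubgroup)
              μ νG : ℝ) : ℂ) * (Cc + B)) := by
  haveI := t2Space_adeleRing_of_numberField L
  haveI := locallyCompactSpace_adeleRing' L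
  haveI := secondCountableTopology_adeleRing L
  haveI : T2Space (quasiSplit (↥(maximalRealSubfield L)) L (IsCMField.complexConj L) 3).Adelic :=
    inferInstanceAs (T2Space (adelic (↥(maximalRealSubfield L)) L (IsCMField.complexConj L) 3
      ((StdForm.antidiagonal 3).over L)))
  haveI : LocallyCompactSpace (quasiSplit (↥(maximalRealSubfield L)) L (IsCMField.complexConj L) 3).Adelic :=
    inferInstanceAs (LocallyCompactSpace (adelic (↥(maximalRealSubfield L)) L (IsCMField.complexConj L) 3
      ((StdForm.antidiagonal 3).over L)))
  haveI : SecondCountableTopology (quasiSplit (↥(maximalRealSubfield L)) L (IsCMField.complexConj L) 3).Adelic :=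
    inferInstanceAs (SecondCountableTopology (adelic (↥(maximalRealSubfield L)) L (IsCMField.complexConj L) 3
      ((StdForm.antidiagonal 3).over L)))
  haveI : νG.IsMulRightInvariant := isMulRightInvariant_quasiSplit_cm_three L νG
  haveI : νG.IsInvInvariant := isInvInvariant_of_isMulRightInvariant νG
  exact truncatedTraceClass_central_eq_linear_of_parts ζ (complexConj_mul_complexConj L)
    (IsCMField.complexConj_ne_one L) hz₁ hcl hclN ν h𝓕 hf.continuous' hf.hasCompactSupport' μ νG hβ
    (truncatedKernelClassIntegrable_cm L hcl' hclN ν 𝓕 h𝓕 μ f hf i) hsplit hCi hCv hE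

end CM

end UnitaryGroup

end Literature.NumberTheory.Automorphic
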